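import Literature.Geometry.Lorentzian.EndHessianAsymptotics
import Literature.Geometry.Lorentzian.HessianLocalMax
import Literature.Geometry.Lorentzian.HypersurfaceHessian
import Literature.Geometry.Lorentzian.DalembertianNaturality
import Literature.Geometry.Lorentzian.ChartMetricCoord
import Literature.Geometry.Lorentzian.MassCapacityHarmonic
import Literature.Geometry.Lorentzian.HypersurfaceRestriction
import HarnessLib

/-!
# Schoen–Yau 1979, (2.5): the height of a minimal surface far out on an end of negative mass

Schoen–Yau, Comm. Math. Phys. 65 (1979), §2 Step 2, pp. 50–51: on an end `N_k` with the
expansion (1.1) and `M < 0`, the coordinate height `x³` restricted to a minimal surface `S_σ`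
cannot attain a maximum `h̄ > σ₀` at an interior point `x₀` far out: *"The tangent space to `S_σ`
at `x₀` is then spanned by `∂/∂x¹(x₀), ∂/∂x²(x₀)` … `Σ qⁱʲ D_{ij} x³ = Σ qⁱʲ ∇_{ij} x³ + Σ qⁱʲ
h_{ij} ν(x³)`. Since `S_σ` is minimal we have `Σ qⁱʲ h_{ij} = 0`, so applying (2.7) we see
`Σ qⁱʲ ∇_{ij} x³ > 0` at `x₀`, contradicting the fact that `x³` attains a maximum there. A
similar argument gives a lower bound"* — hence (2.5): `S_σ ∩ N_k ⊆ E_h = {|x³| ≤ h}` for an `h`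
independent of `σ`.

We prove the pointwise statement for an arbitrary unit direction `u` (the printed `x³` is
`u = e₃`) and an arbitrary spacelike immersed minimal surface `F : S → X` of a `3`-dimensional
initial data set, in the far region of an end with `IsAsymptoticallySchwarzschild e D M 2`, `M < 0`:

* `AFEnd.hessian_dataChart_apply_eq_hessAt` — the covariant Hessian read in the chart of the end
  (`Hess_h φ (Φ z)(dΦ X, dΦ Y) = Hess_G (φ ∘ Φ)(z)(X, Y)`, `G = hCoeff e D`; naturality
  `hessian_comap_apply` and the chart formula `OpensChart.hessian_eq_hessAt`).
* `AFEnd.hessian_inner_coord_pos_of_mem_far` — **(2.7) ⇒ positivity**: for `‖u‖ = 1`,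
  `⟪u, x⟫ ≥ (C+1)/|M|` and a nonzero tangent vector `w` with `⟪u, dx(w)⟫ = 0` (tangent to the
  level set of the height), `Hess_h ⟪u, x⟫ (w, w) > 0`.
* `SchoenYau.not_isLocalMax_height` — **(2.5), pointwise form**: there is `h > 0` (depending on
  the end only) such that for every spacelike immersed surface `F : S → X` with a smooth unit
  normal and mean curvature `H ≡ 0`, every unit `u` and every `y₀ ∈ S` with
  `⟪u, x(F y₀)⟫ > h`, the height `y ↦ ⟪u, x(F y)⟫` does not have a local maximum at `y₀`
  (`Δ_S(φ ∘ F) = tr_S Hess_h φ(dF·, dF·) − dφ(ν) H`, `HypersurfaceHessian.dalembertian_comp_eq`,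
  is `> 0` by the previous item on an orthonormal basis, while `Δ_S ≤ 0` at an interior local
  maximum, `HessianLocalMax.dalembertian_nonpos_of_isLocalMax`).
* `SchoenYau.not_isLocalExtr_height` — both halves of (2.5): no local maximum above `h₀`, no
  local minimum below `−h₀` (the latter from the former with `−u`).

Everything is proved; no named fact and no `sorry` is introduced.

## References

* R. Schoen, S.-T. Yau, *On the proof of the positive mass conjecture in general relativity*,
  Comm. Math. Phys. 65 (1979), 45–76, §2 Step 2, (2.5)–(2.7), pp. 50–51. [SchoenYauPMT1979]
* B. O'Neill, *Semi-Riemannian geometry*, Academic Press (1983), Ch. 3–4. [ONeill1983]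
-/

noncomputable section

open Bundle Set Function Filter Metric ContinuousLinearMap
open scoped Manifold ContDiff Topology RealInnerProductSpace

namespace Literature.Geometry.Lorentzian

open MetricCoord

namespace AFEnd

variable {X : Type} [TopologicalSpace X] [ChartedSpace E3 X] [IsManifold (𝓡 3) ∞ X]
  (e : AFEnd X) (D : InitialDataSet (𝓡 3) X) [D.metric.HasLeviCivita]

/-- **The covariant Hessian read in the chart of the end**: for `φ` of class `C²` at `Φ z` with
chart representative `Φr` (`φ (Φ y) = Φr y` on the exterior region, `Φr` of class `C²` at `z`),
`Hess_h φ (Φ z)(dΦ X₀, dΦ Y₀) = Hess_G Φr (z)(X₀, Y₀)` with `G = hCoeff e D` the chart components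
(naturality of the Hessian under the inverse chart `Φ = dataChart e`, `hessian_comap_apply`, and
the chart formula `OpensChart.hessian_eq_hessAt`). O'Neill 1983, Ch. 3, Lemma 3.49 and
Prop. 3.59. [cite: ONeill1983, Ch. 3, Lemma 3.49] -/
theorem hessian_dataChart_apply_eq_hessAt {φ : X → ℝ} {Φr : E3 → ℝ} (z : exteriorRegion e.R)
    (hφ : ContMDiffAt (𝓡 3) 𝓘(ℝ, ℝ) 2 φ (e.dataChart z))
    (hrepr : ∀ y : exteriorRegion e.R, φ (e.dataChart y) = Φr y)
    (hΦr : ContDiffAt ℝ 2 Φr z) (X₀ Y₀ : E3) :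
    D.metric.hessian φ (e.dataChart z) (mfderiv (𝓡 3) (𝓡 3) e.dataChart z X₀)
        (mfderiv (𝓡 3) (𝓡 3) e.dataChart z Y₀) = hessAt (hCoeff e D) Φr z X₀ Y₀ := by
  set γ := D.metric.comap PseudoRiemannianMetric.contMDiff_pullbackBilin_holds e.dataChart
    e.contMDiff_dataChart_succ e.injective_mfderiv_dataChart rfl with hγ
  haveI : γ.HasLeviCivita := γ.hasLeviCivita
  have hnat := D.metric.hessian_comap_apply PseudoRiemannianMetric.contMDiff_pullbackBilin_holds
    e.contMDiff_dataChart_succ e.injective_mfderiv_dataChart rfl hφ X₀ Y₀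
  rw [← hnat]
  have hrepr' : ∀ y : exteriorRegion e.R, (φ ∘ e.dataChart) y = Φr y := hrepr
  exact OpensChart.hessian_eq_hessAt (e.val_comap_dataChart D) z hrepr' hΦr X₀ Y₀

omit [IsManifold (𝓡 3) ∞ X] [D.metric.HasLeviCivita] in
/-- The coordinate differential inverts the differential of the inverse chart:
`d(coord)_{Φ z}(dΦ_z X₀) = X₀` (`coord ∘ Φ` is the inclusion of the exterior region).
[folklore] -/
theorem mfderiv_coord_mfderiv_dataChart (z : exteriorRegion e.R) (X₀ : E3) :
    mfderiv (𝓡 3) 𝓘(ℝ, E3) e.coord (e.dataChart z) (mfderiv (𝓡 3) (𝓡 3) e.dataChart z X₀) =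
      X₀ := by
  have hzU : e.dataChart z ∈ e.U := (e.chart.symm z).2
  have hc : MDifferentiableAt (𝓡 3) 𝓘(ℝ, E3) e.coord (e.dataChart z) :=
    (e.contMDiffAt_coord hzU).mdifferentiableAt (by simp)
  have hd : MDifferentiableAt (𝓡 3) (𝓡 3) e.dataChart z :=
    e.contMDiff_dataChart.mdifferentiableAt (by simp)
  have hcomp := mfderiv_comp z hc hd
  have hfun : e.coord ∘ e.dataChart = (Subtype.val : exteriorRegion e.R → E3) :=
    funext fun y ↦ e.coord_dataChart y
  rw [hfun] at hcomp
  have hval : HasMFDerivAt (𝓡 3) 𝓘(ℝ, E3) (Subtype.val : exteriorRegion e.R → E3) z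
      (ContinuousLinearMap.id ℝ E3) := hasMFDerivAt_subtypeVal z
  rw [hval.mfderiv] at hcomp
  have h := congrArg (fun L : E3 →L[ℝ] E3 ↦ L X₀) hcomp
  simp only [ContinuousLinearMap.id_apply] at h
  exact h.symm

omit [IsManifold (𝓡 3) ∞ X] [D.metric.HasLeviCivita] in
/-- Every tangent vector at a point of the end is the image of a chart direction under the
differential of the inverse chart (an equidimensional immersion has invertible differential).
[folklore] -/
theorem exists_mfderiv_dataChart_eq (z : exteriorRegion e.R)
    (w : TangentSpace (𝓡 3) (e.dataChart z)) :
    ∃ X₀ : E3, mfderiv (𝓡 3) (𝓡 3) e.dataChart z X₀ = w := by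
  obtain ⟨L, hL⟩ := PseudoRiemannianMetric.isInvertible_mfderiv_of_injective (I := 𝓡 3)
    (I' := 𝓡 3) (Φ := e.dataChart) rfl (e.injective_mfderiv_dataChart z)
  refine ⟨L.symm w, ?_⟩
  rw [← hL]
  simp

omit [IsManifold (𝓡 3) ∞ X] [D.metric.HasLeviCivita] in
/-- The height function `⟪u, coord⟫` is smooth at the points of the end. [folklore] -/
theorem contMDiffAt_inner_coord (u : E3) {q : X} (hq : q ∈ e.U) :
    ContMDiffAt (𝓡 3) 𝓘(ℝ, ℝ) ∞ (fun p ↦ ⟪u, e.coord p⟫) q :=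
  (innerSL ℝ u : E3 →L[ℝ] ℝ).contDiff.comp_contMDiffAt (e.contMDiffAt_coord hq)

omit [IsManifold (𝓡 3) ∞ X] [D.metric.HasLeviCivita] in
/-- The differential of the height function: `d⟪u, coord⟫_q (w) = ⟪u, d(coord)_q w⟫`.
[folklore] -/
theorem mfderiv_inner_coord_apply (u : E3) {q : X} (hq : q ∈ e.U) (w : TangentSpace (𝓡 3) q) :
    mfderiv (𝓡 3) 𝓘(ℝ, ℝ) (fun p ↦ ⟪u, e.coord p⟫) q w =
      ⟪u, mfderiv (𝓡 3) 𝓘(ℝ, E3) e.coord q w⟫ := by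
  have hcd : MDifferentiableAt (𝓡 3) 𝓘(ℝ, E3) e.coord q :=
    (e.contMDiffAt_coord hq).mdifferentiableAt (by simp)
  have hG : MDifferentiableAt 𝓘(ℝ, E3) 𝓘(ℝ, ℝ) (fun v : E3 ↦ ⟪u, v⟫) (e.coord q) :=
    (innerSL ℝ u : E3 →L[ℝ] ℝ).differentiableAt.mdifferentiableAt
  have hcomp : mfderiv (𝓡 3) 𝓘(ℝ, ℝ) ((fun v : E3 ↦ ⟪u, v⟫) ∘ e.coord) q =
      (mfderiv 𝓘(ℝ, E3) 𝓘(ℝ, ℝ) (fun v : E3 ↦ ⟪u, v⟫) (e.coord q)).comp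
        (mfderiv (𝓡 3) 𝓘(ℝ, E3) e.coord q) := mfderiv_comp q hG hcd
  have hD : mfderiv 𝓘(ℝ, E3) 𝓘(ℝ, ℝ) (fun v : E3 ↦ ⟪u, v⟫) (e.coord q) =
      (innerSL ℝ u : E3 →L[ℝ] ℝ) := by
    rw [mfderiv_eq_fderiv]
    exact (innerSL ℝ u : E3 →L[ℝ] ℝ).fderiv
  change mfderiv (𝓡 3) 𝓘(ℝ, ℝ) ((fun v : E3 ↦ ⟪u, v⟫) ∘ e.coord) q w = _
  rw [hcomp, hD]
  rfl

/-- **Schoen–Yau 1979, (2.7) ⇒ positivity of the tangential Hessian of the height.** Suppose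
the chart components satisfy the estimate (2.7) of `EndHessianAsymptotics` beyond the radius `σ`
with constant `C`, and `M < 0`. Then at a point `q` of the end with `‖coord q‖ ≥ σ` and height
`⟪u, coord q⟫ ≥ (C + 1)/|M|` in the unit direction `u`, for every nonzero tangent vector `w`
tangent to the level set of the height (`⟪u, d(coord) w⟫ = 0`):
`Hess_h ⟪u, coord⟫ (q)(w, w) > 0` — the printed "`Σ qⁱʲ ∇_{ij} x³ > 0` at `x₀`" before taking
the trace: with `x = dcoord(w)`, `⟪u, x⟫ = 0`, (2.7) gives
`Hess(w,w) ≥ (−M ⟪u,coord q⟫ − C) r⁻³ ‖x‖² ≥ r⁻³ ‖x‖² > 0`.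
[cite: SchoenYauPMT1979, §2 Step 2, (2.7) and p. 51] -/
theorem hessian_inner_coord_pos_of_mem {M C σ : ℝ} (hM : M < 0)
    (hest : ∀ y : E3, σ ≤ ‖y‖ → ∀ u X Y : E3,
      |hessAt (hCoeff e D) (fun z : E3 ↦ ⟪u, z⟫) y X Y
          - M * (‖y‖ ^ 3)⁻¹ * (⟪y, X⟫ * ⟪u, Y⟫ + ⟪y, Y⟫ * ⟪u, X⟫ - ⟪X, Y⟫ * ⟪u, y⟫)|
        ≤ C * (‖y‖ ^ 3)⁻¹ * ‖u‖ * ‖X‖ * ‖Y‖)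
    {q : X} (hqU : q ∈ e.U) (hσq : σ ≤ ‖e.coord q‖) {u : E3} (hu : ‖u‖ = 1)
    (hh : (C + 1) / (-M) ≤ ⟪u, e.coord q⟫) {w : TangentSpace (𝓡 3) q} (hw : w ≠ 0)
    (horth : ⟪u, mfderiv (𝓡 3) 𝓘(ℝ, E3) e.coord q w⟫ = 0) :
    0 < D.metric.hessian (fun p ↦ ⟪u, e.coord p⟫) q w w := by
  -- write `q = Φ z` and `w = dΦ X₀`
  have hfar : q ∈ e.far e.R := e.mem_far_iff_coord.2 ⟨hqU, e.lt_norm_coord hqU⟩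
  obtain ⟨z, -, rfl⟩ := e.mem_far_iff.1 hfar
  obtain ⟨X₀, rfl⟩ := e.exists_mfderiv_dataChart_eq z w
  rw [e.mfderiv_coord_mfderiv_dataChart z X₀] at horth
  rw [e.coord_dataChart z] at hσq hh
  have hX₀ : X₀ ≠ 0 := by
    rintro rfl
    exact hw (map_zero _)
  have hzU : e.dataChart z ∈ e.U := (e.chart.symm z).2
  have hφ : ContMDiffAt (𝓡 3) 𝓘(ℝ, ℝ) 2 (fun p ↦ ⟪u, e.coord p⟫) (e.dataChart z) :=
    (e.contMDiffAt_inner_coord u hzU).of_le (WithTop.coe_le_coe.mpr le_top)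
  have hrepr : ∀ y : exteriorRegion e.R,
      (fun p ↦ ⟪u, e.coord p⟫) (e.dataChart y) = (fun v : E3 ↦ ⟪u, v⟫) y := fun y ↦ by
    simp only [e.coord_dataChart]
  have hΦr : ContDiffAt ℝ 2 (fun v : E3 ↦ ⟪u, v⟫) z :=
    (innerSL ℝ u : E3 →L[ℝ] ℝ).contDiff.contDiffAt
  rw [e.hessian_dataChart_apply_eq_hessAt D z hφ hrepr hΦr X₀ X₀]
  -- the estimate (2.7) at `z`, with `⟪u, X₀⟫ = 0` and `‖u‖ = 1`
  have h := hest z hσq u X₀ X₀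
  have hP : ⟪(z : E3), X₀⟫ * ⟪u, X₀⟫ + ⟪(z : E3), X₀⟫ * ⟪u, X₀⟫ - ⟪X₀, X₀⟫ * ⟪u, (z : E3)⟫ =
      -(‖X₀‖ ^ 2 * ⟪u, (z : E3)⟫) := by
    rw [horth, real_inner_self_eq_norm_sq]; ring
  rw [hP, hu, mul_one] at h
  have h1 := (abs_le.1 h).1
  have hzpos : 0 < ‖(z : E3)‖ := e.R_pos.trans z.2
  have hB : 0 < (‖(z : E3)‖ ^ 3)⁻¹ * ‖X₀‖ ^ 2 := by
    have := norm_pos_iff.2 hX₀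
    positivity
  have hMz : C + 1 ≤ -M * ⟪u, (z : E3)⟫ := by
    rw [div_le_iff₀ (by linarith)] at hh
    linarith
  have hkey : (C + 1) * ((‖(z : E3)‖ ^ 3)⁻¹ * ‖X₀‖ ^ 2) ≤
      (-M * ⟪u, (z : E3)⟫) * ((‖(z : E3)‖ ^ 3)⁻¹ * ‖X₀‖ ^ 2) :=
    mul_le_mul_of_nonneg_right hMz hB.le
  have hsq : ‖X₀‖ * ‖X₀‖ = ‖X₀‖ ^ 2 := (sq ‖X₀‖).symm
  nlinarith [h1, hkey, hB, hsq]

end AFEnd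

namespace SchoenYau

variable {X : Type} [TopologicalSpace X] [ChartedSpace E3 X] [IsManifold (𝓡 3) ∞ X]
  (e : AFEnd X) (D : InitialDataSet (𝓡 3) X) [D.metric.HasLeviCivita]

set_option maxHeartbeats 800000 in
/-- **Schoen–Yau 1979, (2.5): no interior height maximum far out on a minimal surface** (end of
negative mass). Let `(X, h, k)` be `3`-dimensional initial data whose end `e` has the expansion
(1.1) with `M < 0` (`IsAsymptoticallySchwarzschild e D M 2`). There is `h₀ > 0` (depending only
on the end) such that: for every surface `S` (a `2`-manifold without boundary), every spacelike
immersion `F : S → X` with a smooth unit normal field `ν` and vanishing mean curvature `H ≡ 0`,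
every unit vector `u ∈ ℝ³` and every point `y₀ ∈ S` whose height `⟪u, x(F y₀)⟫` exceeds `h₀`, the
height function `y ↦ ⟪u, x(F y)⟫` (`x = coord`, extended by `0` off the end) does **not** have a
local maximum at `y₀`. Printed for `u = e₃` and the Plateau solutions `S_σ` ("Let `h̄` be the
maximum for `x³` on `S_σ ∩ N_k`, and suppose this maximum occurs at the point `x₀ ∈ S_σ` …
contradicting the fact that `x³` attains a maximum there"), whence `S_σ ∩ N_k ⊆ E_h`.
Proof: `Δ_S(φ ∘ F)(y₀) = tr_S Hess_h φ (dF·, dF·)(y₀)` since `H = 0` (`dalembertian_comp_eq`,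
applied to a smooth cut-off version of `φ = ⟪u, x⟫` agreeing with it near `F y₀`), which is `> 0`
on an orthonormal basis by `hessian_inner_coord_pos_of_mem` (the tangent vectors `dF eₐ` are
tangent to the level set at a critical point), against `Δ_S ≤ 0` at a local maximum.
[cite: SchoenYauPMT1979, §2 Step 2, (2.5) (pp. 50–51)] -/
theorem not_isLocalMax_height {M : ℝ} (hAS : IsAsymptoticallySchwarzschild e D M 2) (hM : M < 0) :
    ∃ h₀ : ℝ, 0 < h₀ ∧ ∀ (S : Type) [TopologicalSpace S]
      [ChartedSpace (EuclideanSpace ℝ (Fin 2)) S] [IsManifold (𝓡 2) ∞ S] (F : S → X)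
      (hpb : PseudoRiemannianMetric.contMDiff_pullbackBilin (𝓡 3) X (𝓡 2) S ∞)
      (hfi : D.metric.IsSpacelikeImmersion (𝓡 2) F) (ν : NormalField (𝓡 3) F),
      ContMDiff (𝓡 2) (𝓡 3).tangent ∞
          (fun y ↦ (TotalSpace.mk' E3 (F y) (ν y) : TangentBundle (𝓡 3) X)) →
      D.metric.IsUnitNormal (𝓡 2) F ν 1 →
      (∀ y, D.metric.meanCurvature F hpb hfi ν y = 0) →
      ∀ u : E3, ‖u‖ = 1 → ∀ y₀ : S, h₀ < ⟪u, e.coord (F y₀)⟫ →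
        ¬ IsLocalMax (fun y ↦ ⟪u, e.coord (F y)⟫) y₀ := by
  obtain ⟨C, σ, hC, hσ, hest⟩ := e.exists_radius_abs_hessAt_hCoeff_inner_sub_le D hAS
  set R₁ : ℝ := e.R + 1 with hR₁
  have hR₁' : e.R < R₁ := by rw [hR₁]; linarith
  have hRpos := e.R_pos
  refine ⟨max (max ((C + 1) / (-M)) σ) (R₁ + 1),
    lt_max_of_lt_right (by rw [hR₁]; linarith), ?_⟩
  intro S _ _ _ F hpb hfi ν hν hun hmin u hu y₀ hy₀ hmax
  -- the point `F y₀` lies far out in the end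
  have hle : ⟪u, e.coord (F y₀)⟫ ≤ ‖e.coord (F y₀)‖ :=
    (real_inner_le_norm _ _).trans (by rw [hu, one_mul])
  have hU : F y₀ ∈ e.U := by
    by_contra hcon
    rw [e.coord_of_not_mem hcon, inner_zero_right] at hy₀
    have : (0 : ℝ) < R₁ + 1 := by rw [hR₁]; linarith
    linarith [le_max_right (max ((C + 1) / (-M)) σ) (R₁ + 1)]
  have hgt₁ : R₁ + 1 < ‖e.coord (F y₀)‖ := ((le_max_right _ _).trans_lt hy₀).trans_le hle
  have hσq : σ ≤ ‖e.coord (F y₀)‖ :=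
    (((le_max_right _ _).trans (le_max_left _ _)).trans hy₀.le).trans hle
  have hh : (C + 1) / (-M) ≤ ⟪u, e.coord (F y₀)⟫ :=
    ((le_max_left _ _).trans (le_max_left _ _)).trans hy₀.le
  have hfar : F y₀ ∈ e.far (R₁ + 1) := e.mem_far_iff_coord.2 ⟨hU, hgt₁⟩
  -- the smooth cut-off version of the height
  set φc : X → ℝ := fun p ↦ Real.smoothTransition (‖e.coord p‖ - R₁) * ⟪u, e.coord p⟫
    with hφcdef
  have hφc : ContMDiff (𝓡 3) 𝓘(ℝ, ℝ) ∞ φc := by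
    intro q
    by_cases hq : q ∈ ((↑) : e.U → X) '' (e.chart ⁻¹' {x | R₁ ≤ ‖(x : E3)‖})
    · obtain ⟨hqU, -⟩ := e.mem_image_preimage_le_norm_iff.1 hq
      exact ((e.contMDiff_endCutoff hR₁') q).mul (e.contMDiffAt_inner_coord u hqU)
    · refine (contMDiffAt_const (c := (0 : ℝ))).congr_of_eventuallyEq ?_
      filter_upwards [e.endCutoff_eventuallyEq_zero hR₁' hq] with p hp
      change Real.smoothTransition (‖e.coord p‖ - R₁) * ⟪u, e.coord p⟫ = (0 : ℝ)
      rw [hp, zero_mul]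
  have hloc : φc =ᶠ[𝓝 (F y₀)] fun p ↦ ⟪u, e.coord p⟫ := by
    filter_upwards [e.endCutoff_eventuallyEq_one hfar] with p hp
    change Real.smoothTransition (‖e.coord p‖ - R₁) * ⟪u, e.coord p⟫ = ⟪u, e.coord p⟫
    rw [hp, one_mul]
  -- the restrictions to the surface
  have hFs : ContMDiff (𝓡 2) (𝓡 3) ∞ F := hfi.contMDiff_self
  have hcont : Tendsto F (𝓝 y₀) (𝓝 (F y₀)) := hFs.continuous.continuousAt
  have hlocS : (fun y ↦ φc (F y)) =ᶠ[𝓝 y₀] fun y ↦ ⟪u, e.coord (F y)⟫ :=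
    hcont.eventually hloc
  have hmaxc : IsLocalMax (fun y ↦ φc (F y)) y₀ := hlocS.isLocalMax_iff.2 hmax
  -- (1) `Δ_S (φc ∘ F)(y₀) ≤ 0` at the local maximum
  set γ := D.metric.inducedMetric F hpb hfi with hγ
  haveI : γ.HasLeviCivita := γ.hasLeviCivita
  have hγpos : ∀ v : TangentSpace (𝓡 2) y₀, v ≠ 0 → 0 < γ.val y₀ v v := fun v hv ↦ hfi.2 y₀ v hv
  have h2le : (2 : ℕ∞ω) ≤ ∞ := WithTop.coe_le_coe.mpr le_top
  have hψc2 : ContMDiffAt (𝓡 2) 𝓘(ℝ, ℝ) 2 (fun y ↦ φc (F y)) y₀ :=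
    ((hφc.comp hFs) y₀).of_le h2le
  have hΔle : γ.dalembertian (fun y ↦ φc (F y)) y₀ ≤ 0 :=
    γ.dalembertian_nonpos_of_isLocalMax hψc2 hmaxc hγpos
  -- (2) `Δ_S (φc ∘ F)(y₀) = tr_S (Hess φc ∘ (dF × dF))` since `H = 0`
  have hdim : Module.finrank ℝ E3 = Module.finrank ℝ (EuclideanSpace ℝ (Fin 2)) + 1 := by
    rw [finrank_euclideanSpace_fin, finrank_euclideanSpace_fin]
  have hΔeq := D.metric.dalembertian_comp_eq hpb hfi hν hun one_ne_zero hdim (hφc.of_le h2le) y₀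
  rw [hmin y₀, mul_zero, sub_zero] at hΔeq
  -- (3) the tangential Hessian is positive on an orthonormal basis
  have hcrit : mfderiv (𝓡 2) 𝓘(ℝ, ℝ) (fun y ↦ ⟪u, e.coord (F y)⟫) y₀ = 0 :=
    Literature.Topology.FourManifolds.IsLocalMax.isMCriticalPt (I := 𝓡 2) hmax
  have horth : ∀ v : TangentSpace (𝓡 2) y₀,
      ⟪u, mfderiv (𝓡 3) 𝓘(ℝ, E3) e.coord (F y₀) (mfderiv (𝓡 2) (𝓡 3) F y₀ v)⟫ = 0 := by
    intro v
    have hφd : MDifferentiableAt (𝓡 3) 𝓘(ℝ, ℝ) (fun p ↦ ⟪u, e.coord p⟫) (F y₀) :=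
      (e.contMDiffAt_inner_coord u hU).mdifferentiableAt (by simp)
    have hFd : MDifferentiableAt (𝓡 2) (𝓡 3) F y₀ := (hFs y₀).mdifferentiableAt (by simp)
    have hcomp : mfderiv (𝓡 2) 𝓘(ℝ, ℝ) ((fun p ↦ ⟪u, e.coord p⟫) ∘ F) y₀ =
        (mfderiv (𝓡 3) 𝓘(ℝ, ℝ) (fun p ↦ ⟪u, e.coord p⟫) (F y₀)).comp
          (mfderiv (𝓡 2) (𝓡 3) F y₀) :=
      mfderiv_comp y₀ hφd hFd
    have h1 : mfderiv (𝓡 2) 𝓘(ℝ, ℝ) ((fun p ↦ ⟪u, e.coord p⟫) ∘ F) y₀ v = 0 := by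
      change mfderiv (𝓡 2) 𝓘(ℝ, ℝ) (fun y ↦ ⟪u, e.coord (F y)⟫) y₀ v = 0
      rw [hcrit]; rfl
    rw [hcomp] at h1
    have h0 : mfderiv (𝓡 3) 𝓘(ℝ, ℝ) (fun p ↦ ⟪u, e.coord p⟫) (F y₀)
        (mfderiv (𝓡 2) (𝓡 3) F y₀ v) = 0 := h1
    rwa [e.mfderiv_inner_coord_apply u hU] at h0
  have htr : 0 < γ.trace y₀ ((D.metric.hessian φc (F y₀)).comp
      (mfderiv (𝓡 2) (𝓡 3) F y₀).toLinearMap (mfderiv (𝓡 2) (𝓡 3) F y₀).toLinearMap) := by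
    obtain ⟨b, hb⟩ := γ.exists_basis_isOrthonormalFrame (x := y₀) hγpos
      (finrank_euclideanSpace_fin (𝕜 := ℝ) (n := 2))
    rw [γ.trace_eq_sum_of_isOrthonormalFrame b hb]
    refine Finset.sum_pos (fun i _ ↦ ?_) Finset.univ_nonempty
    simp only [LinearMap.BilinForm.comp_apply, ContinuousLinearMap.coe_coe]
    rw [D.metric.hessian_congr_of_eventuallyEq hloc]
    have hw : mfderiv (𝓡 2) (𝓡 3) F y₀ (b i) ≠ 0 := by
      intro h0
      have hp := hγpos (b i) (b.ne_zero i)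
      have hval : γ.val y₀ (b i) (b i) = 0 := by
        change D.metric.val (F y₀) (mfderiv (𝓡 2) (𝓡 3) F y₀ (b i))
          (mfderiv (𝓡 2) (𝓡 3) F y₀ (b i)) = 0
        rw [h0, map_zero]
      exact absurd hval hp.ne'
    exact e.hessian_inner_coord_pos_of_mem D hM hest hU hσq hu hh hw (horth (b i))
  -- (4) contradiction
  rw [hΔeq] at hΔle
  exact absurd hΔle (not_le.2 htr)

/-- **Schoen–Yau 1979, (2.5), lower half**: "A similar argument gives a lower bound on
`x³|S_σ ∩ N_k`" — with the same `h₀`, the height `y ↦ ⟪u, x(F y)⟫` has no local **minimum** at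
a point `y₀` with `⟪u, x(F y₀)⟫ < −h₀` (apply `not_isLocalMax_height` to the direction `−u`).
[cite: SchoenYauPMT1979, §2 Step 2, (2.5) (p. 51)] -/
theorem not_isLocalExtr_height {M : ℝ} (hAS : IsAsymptoticallySchwarzschild e D M 2)
    (hM : M < 0) :
    ∃ h₀ : ℝ, 0 < h₀ ∧ ∀ (S : Type) [TopologicalSpace S]
      [ChartedSpace (EuclideanSpace ℝ (Fin 2)) S] [IsManifold (𝓡 2) ∞ S] (F : S → X)
      (hpb : PseudoRiemannianMetric.contMDiff_pullbackBilin (𝓡 3) X (𝓡 2) S ∞)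
      (hfi : D.metric.IsSpacelikeImmersion (𝓡 2) F) (ν : NormalField (𝓡 3) F),
      ContMDiff (𝓡 2) (𝓡 3).tangent ∞
          (fun y ↦ (TotalSpace.mk' E3 (F y) (ν y) : TangentBundle (𝓡 3) X)) →
      D.metric.IsUnitNormal (𝓡 2) F ν 1 →
      (∀ y, D.metric.meanCurvature F hpb hfi ν y = 0) →
      ∀ u : E3, ‖u‖ = 1 → ∀ y₀ : S,
        (h₀ < ⟪u, e.coord (F y₀)⟫ → ¬ IsLocalMax (fun y ↦ ⟪u, e.coord (F y)⟫) y₀) ∧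
        (⟪u, e.coord (F y₀)⟫ < -h₀ → ¬ IsLocalMin (fun y ↦ ⟪u, e.coord (F y)⟫) y₀) := by
  obtain ⟨h₀, hpos, H⟩ := not_isLocalMax_height e D hAS hM
  refine ⟨h₀, hpos, fun S _ _ _ F hpb hfi ν hν hun hmin u hu y₀ ↦ ⟨?_, ?_⟩⟩
  · exact H S F hpb hfi ν hν hun hmin u hu y₀
  · intro hlt hmin'
    have hu' : ‖-u‖ = 1 := by rw [norm_neg, hu]
    have hgt : h₀ < ⟪-u, e.coord (F y₀)⟫ := by rw [inner_neg_left]; linarith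
    refine H S F hpb hfi ν hν hun hmin (-u) hu' y₀ hgt ?_
    have hneg : (fun y ↦ ⟪-u, e.coord (F y)⟫) = fun y ↦ -⟪u, e.coord (F y)⟫ := by
      funext y; rw [inner_neg_left]
    rw [hneg]
    exact hmin'.neg

end SchoenYau

end Literature.Geometry.Lorentzian

end
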